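import Summits.BirchSwinnertonDyer.BirchSwinnertonDyer.Theorems.EisensteinPrimesFullDescentMultiplicativeUnipotentLine
import Summits.BirchSwinnertonDyer.BirchSwinnertonDyer.Theorems.EisensteinPrimesFullDescentOrdinaryKernelRat
import Summits.BirchSwinnertonDyer.BirchSwinnertonDyer.Theorems.EisensteinPrimesAnomalousLocalMover
import Literature.NumberTheory.EllipticCurves.SupersingularIrreducibleProofs
import HarnessLib

/-!
# Route `EisensteinPrimes`, crux 2 `GoodLatticeBDPValue` (stmt-BirchSwinnertonDyer-19032), line `halves` v25, road
# R5 / AN-5 (the `p ≥ 5` twin of stub 3a-B), brick **LS-ω_p**: under the crux's normalisation binder «no rational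
# `p`-line is unramified at `p`», the isogeny character of the rational `p`-line of a semistable curve with good
# ordinary reduction at the odd prime `p` **is the mod `p` cyclotomic character** `χ̄_p` (the line is the `ω`-line)

Cell `bsd-eis` (home `run/shared/lean/pub/bsd-eis/`), width seat `bsd-line-x1-p1-w5` (gen 6; `--supports -19032`,
closes nothing by itself). Brick LS-ω_p of the road R5 / AN-5 led by width seat w7 gen 7 (bus 2026-08-28 21:34Z /
21:47Z: make the composed-print name `KellerYin2024.thm222_anacong_goodLattice_of_five_le` a corollary of 3a-A
`…_of_fullDescentDatum` through «T‴: at `5 ≤ p`, good, reducible, no unramified rational line ⟹ a full-descent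
datum»; this brick is the `p`-twin of Lemma S′ / `FullDescentSpecPieces.lemmaS_spec` with the normalisation binder
in place of Theorem B).

MATHEMATICS (memo `HOME/line-x1-p1-w3-g4/AN3-StubB-elementary-road.md` §2 L0–L1 at a general odd `p`). Let `E/ℚ` be
semistable with good ORDINARY reduction at the odd prime `p`, `Φ = ⟨P⟩ ≤ E[p]` a rational line with isogeny
character `r : Γ_ℚ → (ℤ/p)ˣ`.
* Lemma S′ (tree, any prime: `FullDescentMultiplicativeUnipotentLine.exists_lineCharacter_eq_pow_of_good_or_mult`):
  `r = χ̄_p^k` — `r` is unramified away from `p` (Néron–Ogg–Shafarevich at the good places, unipotent inertia at the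
  multiplicative ones), then Mazur 1978 Lemma 5.2 + «`ℚ` has no unramified abelian extension».
* At `p` (Serre 1972 §1.11: tree `FullDescentOrdinaryNine.Rat.exists_ordinary_reduction_kernels_of_hasGoodReductionAtPrime`):
  the kernel of reduction `Λ ≤ E[p]` has order `p`, the inertia group `I_p` acts on `Λ` through `χ̄_p` and
  trivially on `E[p]/Λ`.  If `Φ` is NOT unramified at `p` (the crux binder
  `∀ Φ, IsRationalLine W p Φ → ¬ LineUnramifiedAt W p Φ`), some `τ ∈ I_p` moves `P`
  (`AnomalousLocalTorsion.exists_mem_inertia_smul_ne_of_not_lineUnramifiedAt`, any prime of `ℤ̄` above `p`; at the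
  prime cut out by `ℚ̄ → ℚ̄_p` the inertia group is `res (I_{ℚ_p})`, `inertia_adicCompletionPrime_eq_map_absInertia`),
  so `Φ ⊓ Λ ≠ 0` (else `τ P − P ∈ Φ ⊓ Λ = 0` for every `τ ∈ I_p`), i.e. `Φ = Λ`, and `r|_{I_p} = χ̄_p|_{I_p}`:
  `χ̄_p(τ)^k = χ̄_p(τ)` on `I_p`.  Since `χ̄_p(I_p) = (ℤ/p)ˣ` (`ℚ_p(ζ_p)/ℚ_p` totally ramified:
  `Rat.exists_mem_absInertia_modNCyclotomicCharacter_absGaloisRestrict_eq`), `u^k = u` for every unit, hence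
  `r = χ̄_p^k = χ̄_p` on all of `Γ_ℚ`.

* §1 `isRationalLine_zmultiples` (`⟨P⟩` is a rational `p`-line), `units_eq_of_val_smul_eq` (units of `ℤ/p` acting on a
  point of order `p` through `val` are told apart).
* §2 **`lineCharacter_eq_modNCyclotomicCharacter`** — the statement above (hypotheses: `p ≠ 2`, `p` good with
  `p ∤ a_p`, `Semistable W`, `P ≠ 0` with character `r`, `¬ LineUnramifiedAt W p ⟨P⟩`; conclusion `r = χ̄_p`).
* §3 shapes for the assembly ASM_p of the road: `lemmaSOmega_spec` (the `hS`-slot shape of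
  `FullDescentAssembly.fullDescentAtThreeOfRed_of_pieces` with the binder added and the `𝟙`-disjunct gone) and
  **`exists_omega_point_of_red`** (`2 < p`, `Good W p`, `Red W p`, `Semistable W`, the binder ⟹ a point `Q ≠ 0` of
  `E[p]` with `σ Q = χ̄_p(σ) Q` — the input of Theorem A_p; ordinarity from `goodOrd_of_red_of_good`).

HONEST FRAMING: helper theorems only (0 definitions, 0 named facts, 0 sorry, 0 instances); no summit statement, no
BSD / IMC / Keller–Yin theorem, no stub of the registered skeleton `halves` v25 is proved here; T‴ itself needs the
other bricks of the road (HS-1/HS-2, TA-p, A-I_p, A-II_p, G2, ASM_p). References: [Mazur1978] §5 Lemma 5.2–5.3,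
Prop. 5.1 (pp. 149–152); [SerreInventiones1972] §1.11 Prop. 11 and Cor., §1.12; [Kriz2016] Thm. 34 (1), Rem. 33;
[GreenbergVatsal2000] Thm. 1.3 («unramified at p»); [NeukirchANT1999] Ch. II §9 Prop. (9.6).
-/

set_option autoImplicit false

-- the route's Theorems namespace repeats the summit name by design (D-0017 nested layout)
set_option linter.dupNamespace false

noncomputable section

open scoped Classical NumberField

namespace Summit.BirchSwinnertonDyer.BirchSwinnertonDyer.Theorems.FullDescentLemmaSOmega

open NumberField IsDedekindDomain Field WeierstrassCurve Rat.HeightOneSpectrum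
  Literature.NumberTheory.EllipticCurves Literature.NumberTheory.GaloisRepresentations
  Literature.NumberTheory.EllipticCurves.Rank1Residual
  Summit.BirchSwinnertonDyer.BirchSwinnertonDyer.Theorems

variable {W : WeierstrassCurve ℚ} [W.IsElliptic] {p : ℕ} [hp : Fact p.Prime]

/-! ## §1. The rational line `⟨P⟩` and scalar bookkeeping -/

omit [W.IsElliptic] in
/-- The line `⟨P⟩` spanned by a point `P ≠ 0` of `E[p]` carrying an isogeny character is a rational `p`-line
(order `p`, `Γ_ℚ`-stable) — the `p`-twin of `FullDescentAssembly.isRationalLine_zmultiples`. [folklore] -/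
theorem isRationalLine_zmultiples {P : geomTorsion W (p : ℤ)} (hP0 : P ≠ 0)
    {r : absoluteGaloisGroup ℚ →* (ZMod p)ˣ}
    (hr : ∀ σ : absoluteGaloisGroup ℚ, σ • P = ((r σ : (ZMod p)ˣ) : ZMod p).val • P) :
    IsRationalLine W p (AddSubgroup.zmultiples P) := by
  refine ⟨?_, fun σ Q hQ ↦ ?_⟩
  · rw [Nat.card_zmultiples, addOrderOf_eq_of_ne_zero W p hP0]
  · obtain ⟨k, rfl⟩ := AddSubgroup.mem_zmultiples_iff.mp hQ
    have h1 : σ • (k • P) = k • (σ • P) := map_zsmul (DistribSMul.toAddMonoidHom _ σ) k P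
    rw [h1, hr σ]
    exact AddSubgroup.zsmul_mem _ (AddSubgroup.nsmul_mem _ (AddSubgroup.mem_zmultiples P) _) _

omit [W.IsElliptic] in
/-- Two units of `ℤ/p` that act alike (through `val`) on a point of `E(ℚ̄)` of order `p` are equal. [folklore] -/
theorem units_eq_of_val_smul_eq {P : geomTorsion W (p : ℤ)} (hP0 : P ≠ 0) {a b : (ZMod p)ˣ}
    (h : ((a : ZMod p)).val • (P : geomPoints W) = ((b : ZMod p)).val • (P : geomPoints W)) : a = b := by
  have hordP : addOrderOf (P : geomPoints W) = p := by
    rw [AddSubgroup.addOrderOf_coe, addOrderOf_eq_of_ne_zero W p hP0]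
  have hk : (((a : ZMod p).val : ℤ) - ((b : ZMod p).val : ℤ)) • (P : geomPoints W) = 0 := by
    rw [sub_zsmul, natCast_zsmul, natCast_zsmul, h]
    exact add_neg_cancel _
  have hdvd : (p : ℤ) ∣ ((a : ZMod p).val : ℤ) - ((b : ZMod p).val : ℤ) := by
    have h' : ((addOrderOf (P : geomPoints W) : ℕ) : ℤ) ∣ ((a : ZMod p).val : ℤ) - ((b : ZMod p).val : ℤ) :=
      (addOrderOf_dvd_iff_zsmul_eq_zero).mpr hk
    rwa [hordP] at h'
  have h0 : ((((a : ZMod p).val : ℤ) - ((b : ZMod p).val : ℤ) : ℤ) : ZMod p) = 0 :=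
    (ZMod.intCast_zmod_eq_zero_iff_dvd _ p).mpr hdvd
  rw [Int.cast_sub, Int.cast_natCast, Int.cast_natCast, ZMod.natCast_zmod_val, ZMod.natCast_zmod_val,
    sub_eq_zero] at h0
  exact Units.ext h0

/-! ## §2. LS-ω_p: a ramified-at-`p` rational line of a semistable good ordinary curve is the `ω`-line -/

/-- **LS-ω_p.** `W/ℚ` globally minimal and SEMISTABLE, `p` an ODD prime of good ORDINARY reduction (`p ∤ a_p`),
`P ≠ 0` a point of `E[p]` with isogeny character `r` (`σ P = r(σ) P`) whose line `⟨P⟩` is NOT unramified at `p`.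
Then `r = χ̄_p`, the mod `p` cyclotomic character.  (Lemma S′ gives `r = χ̄_p^k`; at `p` the line meets Serre's
kernel of reduction `Λ` non-trivially — a line meeting `Λ` trivially is fixed by the inertia group, which is
unipotent modulo `Λ` —, so it IS `Λ`, on which inertia acts through `χ̄_p`; and `χ̄_p` maps the inertia group onto
`(ℤ/p)ˣ`, so `u^k = u` for every unit.) [cite: Mazur1978, §5 Lemma 5.2–5.3, Prop. 5.1 (pp. 149–152)]
[cite: SerreInventiones1972, §1.11 Prop. 11 and Cor., §1.12] [cite: Kriz2016, Thm. 34 (1)] -/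
theorem lineCharacter_eq_modNCyclotomicCharacter [W.IsGloballyMinimal] (hp2 : p ≠ 2)
    (hgood : W.HasGoodReductionAtPrime p) (hord : ¬ (p : ℤ) ∣ W.frobeniusTrace p) (hsemi : Semistable W)
    {P : geomTorsion W (p : ℤ)} (hP0 : P ≠ 0) {r : absoluteGaloisGroup ℚ →* (ZMod p)ˣ}
    (hr : ∀ σ : absoluteGaloisGroup ℚ, σ • P = ((r σ : (ZMod p)ˣ) : ZMod p).val • P)
    (hram : ¬ LineUnramifiedAt W p (AddSubgroup.zmultiples P)) :
    ∀ σ : absoluteGaloisGroup ℚ, r σ = modNCyclotomicCharacter ℚ p σ := by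
  have hpp : p.Prime := hp.out
  -- Lemma S′: `r = χ̄_p ^ k`
  have hred : ∀ v : HeightOneSpectrum (𝓞 ℚ), (p : 𝓞 ℚ) ∉ v.asIdeal →
      W.HasGoodReductionAt v ∨ W.HasMultiplicativeReductionAt v := by
    intro v _
    haveI hℓ : Fact (primesEquiv v : ℕ).Prime := Fact.mk (primesEquiv v).2
    have hℓv : (((primesEquiv v : Nat.Primes) : ℕ) : 𝓞 ℚ) ∈ v.asIdeal := natCast_mem_asIdeal_of_primesEquiv_eq rfl
    rcases hsemi (primesEquiv v : ℕ) (primesEquiv v).2 with hg | hm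
    · exact Or.inl (W.hasGoodReductionAt_of_hasGoodReductionAtPrime v hℓv hg)
    · exact Or.inr (Summit.BirchSwinnertonDyer.Rank1Residual.X2.GreenbergVatsalStrictSelmerMultiplicative.hasMultiplicativeReductionAt_of_mem
        W (primesEquiv v : ℕ) hm hℓv)
  obtain ⟨k, hk⟩ := FullDescentMultiplicativeUnipotentLine.exists_lineCharacter_eq_pow_of_good_or_mult W p hP0 hr hred
  -- the place `v` above `p` and Serre's kernel of reduction `Λ ≤ E[p]` there
  obtain ⟨v, hv'⟩ : ∃ v : HeightOneSpectrum (𝓞 ℚ), primesEquiv v = ⟨p, hpp⟩ :=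
    ⟨(primesEquiv (R := 𝓞 ℚ)).symm ⟨p, hpp⟩, Equiv.apply_symm_apply _ _⟩
  have hv : natGenerator v = p := congrArg Subtype.val hv'
  have hpv : (p : 𝓞 ℚ) ∈ v.asIdeal := (Rat.natCast_mem_asIdeal_iff v).mpr (hv ▸ dvd_refl _)
  obtain ⟨Λ, K₂, -, -, -, -, -, -, -, hquot, -, -, hΛχ, -⟩ :=
    FullDescentOrdinaryNine.Rat.exists_ordinary_reduction_kernels_of_hasGoodReductionAtPrime W p hp2 hgood hord v hpv
  -- the line `N = ⟨P⟩` in `E(ℚ̄)`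
  set N : AddSubgroup (geomPoints W) := AddSubgroup.zmultiples (P : geomPoints W) with hN
  have hPtors : (P : geomPoints W) ∈ geomTorsion W (p : ℤ) := P.2
  have hordP : addOrderOf (P : geomPoints W) = p := by
    rw [AddSubgroup.addOrderOf_coe, addOrderOf_eq_of_ne_zero W p hP0]
  have hcN : Nat.card N = p := by rw [hN, Nat.card_zmultiples, hordP]
  have hrc : ∀ σ : absoluteGaloisGroup ℚ,
      σ • (P : geomPoints W) = ((r σ : (ZMod p)ˣ) : ZMod p).val • (P : geomPoints W) := fun σ ↦ by
    rw [← AddSubgroup.torsionBy.coe_smul, hr σ, AddSubgroupClass.coe_nsmul]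
  -- a MOVER in the local inertia group at `v` (the line is not unramified at `p`)
  have hmov : ∃ τ ∈ absInertia (v.adicCompletion ℚ),
      absGaloisRestrict ℚ (v.adicCompletion ℚ) τ • (P : geomPoints W) ≠ P := by
    obtain ⟨σ, hσ, Q, hQ, hne⟩ := AnomalousLocalTorsion.exists_mem_inertia_smul_ne_of_not_lineUnramifiedAt
      (isRationalLine_zmultiples hP0 hr) hram hpv (adicCompletionPrime_mem_primesAbove ℚ v)
    rw [inertia_adicCompletionPrime_eq_map_absInertia ℚ v] at hσ
    obtain ⟨τ, hτ, rfl⟩ := Subgroup.mem_map.mp hσ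
    refine ⟨τ, hτ, fun hfix ↦ hne ?_⟩
    obtain ⟨m, rfl⟩ := AddSubgroup.mem_zmultiples_iff.mp hQ
    have hfixP : (absGaloisRestrict ℚ (v.adicCompletion ℚ)).toMonoidHom τ • P = P :=
      Subtype.ext (by rw [AddSubgroup.torsionBy.coe_smul]; exact hfix)
    have h1 : (absGaloisRestrict ℚ (v.adicCompletion ℚ)).toMonoidHom τ • (m • P) =
        m • ((absGaloisRestrict ℚ (v.adicCompletion ℚ)).toMonoidHom τ • P) :=
      map_zsmul (DistribSMul.toAddMonoidHom _ ((absGaloisRestrict ℚ (v.adicCompletion ℚ)).toMonoidHom τ)) m P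
    rw [h1, hfixP]
  obtain ⟨τ₀, hτ₀, hmove⟩ := hmov
  -- `P ∈ Λ`: otherwise `N ⊓ Λ = 0` and the inertia group, unipotent modulo `Λ`, would fix `P`
  have hPΛ : (P : geomPoints W) ∈ Λ := by
    by_contra hPΛ
    have hinf : N ⊓ Λ = ⊥ := by
      have hle : N ⊓ Λ ≤ N := inf_le_left
      have hdvd : Nat.card ↥(N ⊓ Λ) ∣ p := hcN ▸ AddSubgroup.card_dvd_of_le hle
      rcases (Nat.dvd_prime hpp).mp hdvd with h1 | hp'
      · exact AddSubgroup.eq_bot_of_card_eq _ h1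
      · exfalso
        apply hPΛ
        haveI : Finite N := Nat.finite_of_card_ne_zero (by rw [hcN]; exact hpp.ne_zero)
        have heq : N ⊓ Λ = N := AddSubgroup.eq_of_le_of_card_ge hle (by rw [hp', hcN])
        have hPN : (P : geomPoints W) ∈ N ⊓ Λ := by rw [heq]; exact AddSubgroup.mem_zmultiples _
        exact (AddSubgroup.mem_inf.mp hPN).2
    apply hmove
    have hd : absGaloisRestrict ℚ (v.adicCompletion ℚ) τ₀ • (P : geomPoints W) - P ∈ N ⊓ Λ := by
      refine AddSubgroup.mem_inf.mpr ⟨?_, hquot τ₀ hτ₀ _ hPtors⟩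
      rw [hrc]
      exact N.sub_mem (N.nsmul_mem (AddSubgroup.mem_zmultiples _) _) (AddSubgroup.mem_zmultiples _)
    rw [hinf, AddSubgroup.mem_bot, sub_eq_zero] at hd
    exact hd
  -- on `Λ ∋ P` inertia acts through `χ̄_p`, on `⟨P⟩` through `r = χ̄_p^k`; `χ̄_p(I_p) = (ℤ/p)ˣ`
  have hpow : ∀ u : (ZMod p)ˣ, u ^ k = u := by
    intro u
    obtain ⟨τ, hτ, hτu⟩ :=
      FullDescentOrdinaryNine.Rat.exists_mem_absInertia_modNCyclotomicCharacter_absGaloisRestrict_eq p v hpv u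
    have h1 := hΛχ τ hτ _ hPΛ
    have h2 := hrc (absGaloisRestrict ℚ (v.adicCompletion ℚ) τ)
    rw [hk, hτu] at h2
    rw [hτu] at h1
    exact units_eq_of_val_smul_eq hP0 (h2.symm.trans h1)
  intro σ
  rw [hk σ]
  exact hpow _

/-! ## §3. Shapes for the assembly of the road (ASM_p) -/

/-- **LS-ω_p in the `hS`-slot shape of an assembly à la `FullDescentAssembly.fullDescentAtThreeOfRed_of_pieces`**
(general odd `p`, the normalisation binder of the crux added, the `𝟙`-disjunct gone): `p ≠ 2` good with `p ∤ a_p`,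
`W` semistable, no rational `p`-line unramified at `p`, `P ≠ 0` with isogeny character `r` ⟹ `r = χ̄_p`.
[cite: Mazur1978, §5 Lemma 5.2–5.3] [cite: SerreInventiones1972, §1.11 Prop. 11, §1.12] -/
theorem lemmaSOmega_spec : ∀ (W : WeierstrassCurve ℚ) [W.IsElliptic] [W.IsGloballyMinimal] (p : ℕ) [Fact p.Prime],
    p ≠ 2 → W.HasGoodReductionAtPrime p → ¬ (p : ℤ) ∣ W.frobeniusTrace p → Semistable W →
    (∀ Φ : AddSubgroup (geomTorsion W (p : ℤ)), IsRationalLine W p Φ → ¬ LineUnramifiedAt W p Φ) →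
    ∀ {P : geomTorsion W (p : ℤ)}, P ≠ 0 → ∀ {r : absoluteGaloisGroup ℚ →* (ZMod p)ˣ},
      (∀ σ : absoluteGaloisGroup ℚ, σ • P = ((r σ : (ZMod p)ˣ) : ZMod p).val • P) →
      ∀ σ : absoluteGaloisGroup ℚ, r σ = modNCyclotomicCharacter ℚ p σ :=
  fun _ _ _ _ _ hp2 hgood hord hsemi hnorm _ hP0 _ hr ↦
    lineCharacter_eq_modNCyclotomicCharacter hp2 hgood hord hsemi hP0 hr
      (hnorm _ (isRationalLine_zmultiples hP0 hr))

/-- **The `ω`-point of the road at `p`.** `W/ℚ` globally minimal and semistable, `2 < p` a good prime with `E[p]`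
reducible (`Red W p`: a rational `p`-isogeny) and no rational `p`-line unramified at `p`: then some `Q ≠ 0` in
`E[p]` carries the mod `p` cyclotomic character, `σ Q = χ̄_p(σ) Q` — the input of Theorem A_p of the road
(reducible ⟹ a rational line `⟨P⟩` with an isogeny character, Mazur 1978 §5; a good Eisenstein `p > 2` is
ordinary, `goodOrd_of_red_of_good`; then §2). [cite: Mazur1978, §5 (pp. 148–152)]
[cite: SerreInventiones1972, §1.11 Prop. 11–12] [cite: Kriz2016, Thm. 34 (1), Rem. 33] -/
theorem exists_omega_point_of_red [W.IsGloballyMinimal] (hp2 : 2 < p) (hgood : Good W p) (hred : Red W p)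
    (hsemi : Semistable W)
    (hnorm : ∀ Φ : AddSubgroup (geomTorsion W (p : ℤ)), IsRationalLine W p Φ → ¬ LineUnramifiedAt W p Φ) :
    ∃ Q : geomTorsion W (p : ℤ), Q ≠ 0 ∧
      ∀ σ : absoluteGaloisGroup ℚ, σ • Q = ((modNCyclotomicCharacter ℚ p σ : (ZMod p)ˣ) : ZMod p).val • Q := by
  have hord : ¬ (p : ℤ) ∣ W.frobeniusTrace p := (goodOrd_of_red_of_good W p hp2 hgood hred).2
  obtain ⟨H, hHst, hHcard⟩ := (Mazur1978.not_hasIrreducibleModPGaloisRep_iff_exists_natCard_eq W p).mp hred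
  obtain ⟨P, hP0, rfl⟩ := Mazur1978.exists_eq_zmultiples_of_natCard_eq W p hHcard
  obtain ⟨r, hr⟩ := Mazur1978.exists_isogenyCharacter W p hP0 (fun σ ↦ hHst σ P (AddSubgroup.mem_zmultiples P))
  have hω := lineCharacter_eq_modNCyclotomicCharacter (by omega) hgood hord hsemi hP0 hr
    (hnorm _ (isRationalLine_zmultiples hP0 hr))
  exact ⟨P, hP0, fun σ ↦ by rw [hr σ, hω σ]⟩

end Summit.BirchSwinnertonDyer.BirchSwinnertonDyer.Theorems.FullDescentLemmaSOmega

end
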